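import Literature.GroupTheory.FiniteAbelian.RankTorsionKilling
import Mathlib.LinearAlgebra.Dimension.Localization
import HarnessLib

/-!
# The rank of the quotient of a finitely generated abelian group by a cyclic subgroup, and
# elements detected by integral functionals

Topic `Literature/GroupTheory/FiniteAbelian`; companion of `RankTorsionKilling.lean` (the algebra of
M. Kervaire, J. Milnor, *Groups of homotopy spheres I*, Ann. of Math. (2) 77 (1963), §5). In the
proof of **Lemma 5.8** (p. 516: "If `k` is even then the modification `χ(φ)` necessarily changes the
`k`-th Betti number of `M`") the Betti numbers of `M` and of `M' = χ(M, φ)` are read off from the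
two exact sequences of Lemma 5.6, `H_kM ≅ H_kM₀/ε'(Z)` and `H_kM' ≅ H_kM₀/ε(Z)`: the rank of the
quotient of a finitely generated abelian group `N` by the cyclic subgroup `xℤ` is `rank N` or
`rank N - 1` according as `x` has finite or infinite order. This file proves that book-keeping and
the dual characterisation of finite order used with Poincaré duality ("`μ · λ = 0` for all `μ`"):

* `finrank_quotient_zmultiples_of_isOfFinAddOrder` — `rank (N / xℤ) = rank N` if `x` has finite
  order;
* `finrank_quotient_zmultiples_add_one_of_not_isOfFinAddOrder` — `rank (N / xℤ) + 1 = rank N` if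
  `x` has infinite order (rank–nullity over the domain `ℤ`, `IsDomain.hasRankNullity`);
* `addMonoidHom_apply_eq_zero_of_isOfFinAddOrder`, `isOfFinAddOrder_of_forall_addMonoidHom_eq_zero`
  — an element of a finitely generated abelian group has finite order iff every homomorphism to `ℤ`
  kills it (structure theorem, `AddCommGroup.equiv_free_prod_directSum_zmod`).

Ranks are `Module.finrank ℤ`. Everything is proved from Mathlib; no definitions, no named facts.

## References

* M. Kervaire, J. Milnor, *Groups of homotopy spheres I*, Ann. of Math. (2) 77 (1963), Lemma 5.6
  and Lemma 5.8 (pp. 514–518). doi:10.2307/1970128 [KervaireMilnorAnnals1963]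
* T. W. Hungerford, *Algebra*, GTM 73, Springer 1974, Ch. II Thm. 2.1 and Thm. 2.6 (structure of
  finitely generated abelian groups, rank). [Hungerford1974]
-/

open AddSubgroup

namespace Literature.GroupTheory.FiniteAbelian

/-! ### Functionals and finite order -/

/-- A homomorphism to `ℤ` kills every element of finite order (`n • x = 0` gives `n • f x = 0` in the
torsion-free group `ℤ`). [folklore] -/
theorem addMonoidHom_apply_eq_zero_of_isOfFinAddOrder {N : Type*} [AddCommGroup N] {x : N}
    (hx : IsOfFinAddOrder x) (f : N →+ ℤ) : f x = 0 := by
  obtain ⟨n, hn, hnx⟩ := hx.exists_nsmul_eq_zero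
  have h : (n : ℤ) * f x = 0 := by
    rw [← nsmul_eq_mul, ← map_nsmul, hnx, map_zero]
  rcases mul_eq_zero.1 h with h | h
  · exact absurd h (by exact_mod_cast hn.ne')
  · exact h

/-- **An element of a finitely generated abelian group killed by every homomorphism to `ℤ` has
finite order** (structure theorem: in `N ≅ ℤⁿ × T` the free coordinates of such an element
vanish, so it lies in the finite group `T`; Hungerford 1974, II Thm. 2.1). [cite: Hungerford1974, Ch. II Thm. 2.1] -/
theorem isOfFinAddOrder_of_forall_addMonoidHom_eq_zero {N : Type*} [AddCommGroup N] [AddGroup.FG N]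
    {x : N} (h : ∀ f : N →+ ℤ, f x = 0) : IsOfFinAddOrder x := by
  obtain ⟨n, κ, _, p, hp, e, ⟨φ⟩⟩ := AddCommGroup.equiv_free_prod_directSum_zmod N
  haveI : ∀ i, NeZero (p i ^ e i) := fun i => ⟨pow_ne_zero _ (hp i).ne_zero⟩
  haveI : Finite (DirectSum κ fun i => ZMod (p i ^ e i)) := by
    classical
    haveI : ∀ i, Finite (ZMod (p i ^ e i)) := fun i => Finite.of_fintype _
    exact Finite.of_equiv (∀ i, ZMod (p i ^ e i)) (DirectSum.linearEquivFunOnFintype ℤ κ _).toEquiv.symm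
  -- the free coordinates of `φ x` vanish
  have hfree : (φ x).1 = 0 := by
    ext i
    have := h ((Finsupp.applyAddHom i).comp ((AddMonoidHom.fst _ _).comp φ.toAddMonoidHom))
    simpa using this
  -- so `φ x = (0, t)` has finite order, and so has `x`
  have hφx : IsOfFinAddOrder (φ x) := by
    have hx2 : IsOfFinAddOrder (φ x).2 := isOfFinAddOrder_of_finite _
    obtain ⟨m, hm, hm2⟩ := hx2.exists_nsmul_eq_zero
    refine isOfFinAddOrder_iff_nsmul_eq_zero.2 ⟨m, hm, ?_⟩
    ext1
    · rw [Prod.smul_fst, hfree, smul_zero, Prod.fst_zero]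
    · rw [Prod.smul_snd, hm2, Prod.snd_zero]
  simpa using φ.symm.toAddMonoidHom.isOfFinAddOrder hφx

/-! ### The rank of `N / xℤ` -/

/-- **Quotient by an element of finite order: the rank is unchanged.** For `N` finitely generated
and `x` of finite order, `rank (N / xℤ) = rank N` (rank–nullity over `ℤ` with `rank xℤ = 0`).
[cite: Hungerford1974, Ch. II Thm. 2.6] -/
theorem finrank_quotient_zmultiples_of_isOfFinAddOrder {N : Type*} [AddCommGroup N] [AddGroup.FG N]
    {x : N} (hx : IsOfFinAddOrder x) :
    Module.finrank ℤ (N ⧸ zmultiples x) = Module.finrank ℤ N := by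
  haveI : Module.Finite ℤ N := Module.Finite.iff_addGroup_fg.2 ‹_›
  -- `xℤ` as a `ℤ`-submodule, of rank `0` (it is finite)
  set S : Submodule ℤ N := Submodule.span ℤ {x} with hS
  have hSx : S.toAddSubgroup = zmultiples x := by
    rw [hS, Submodule.span_int_eq_addSubgroupClosure, AddSubgroup.zmultiples_eq_closure]
  haveI : Finite S := by
    change Finite (S.toAddSubgroup : Set N)
    rw [hSx]
    exact (finite_zmultiples.2 hx).to_subtype
  have h0 : Module.finrank ℤ S = 0 := finrank_int_eq_zero_of_finite S
  have h1 := Submodule.finrank_quotient_add_finrank S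
  rw [h0, add_zero] at h1
  -- `N / xℤ` (groups) is `N / S` (modules)
  rw [← h1]
  have e : N ⧸ zmultiples x ≃+ N ⧸ S :=
    QuotientAddGroup.quotientAddEquivOfEq hSx.symm
  have := e.toIntLinearEquiv.finrank_eq
  convert this using 2 <;> rfl

/-- **Quotient by an element of infinite order: the rank drops by one.** For `N` finitely
generated and `x` of infinite order, `rank (N / xℤ) + 1 = rank N` (rank–nullity over `ℤ` with
`xℤ ≅ ℤ`). [cite: Hungerford1974, Ch. II Thm. 2.6] -/
theorem finrank_quotient_zmultiples_add_one_of_not_isOfFinAddOrder {N : Type*} [AddCommGroup N]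
    [AddGroup.FG N] {x : N} (hx : ¬IsOfFinAddOrder x) :
    Module.finrank ℤ (N ⧸ zmultiples x) + 1 = Module.finrank ℤ N := by
  haveI : Module.Finite ℤ N := Module.Finite.iff_addGroup_fg.2 ‹_›
  set S : Submodule ℤ N := Submodule.span ℤ {x} with hS
  have hSx : S.toAddSubgroup = zmultiples x := by
    rw [hS, Submodule.span_int_eq_addSubgroupClosure, AddSubgroup.zmultiples_eq_closure]
  -- `ℤ ≅ xℤ` by `a ↦ a • x` (injective since `x` has infinite order)
  have hinj : Function.Injective (LinearMap.toSpanSingleton ℤ N x) := by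
    rw [injective_iff_map_eq_zero]
    intro a ha
    rw [LinearMap.toSpanSingleton_apply] at ha
    by_contra ha0
    exact hx (isOfFinAddOrder_iff_zsmul_eq_zero.2 ⟨a, ha0, ha⟩)
  have h1S : Module.finrank ℤ S = 1 := by
    have e : ℤ ≃ₗ[ℤ] S :=
      (LinearEquiv.ofInjective _ hinj).trans (LinearEquiv.ofEq _ _ (LinearMap.span_singleton_eq_range ℤ N x).symm)
    rw [← e.finrank_eq, Module.finrank_self]
  have h1 := Submodule.finrank_quotient_add_finrank S
  rw [h1S] at h1
  rw [← h1]
  have e : N ⧸ zmultiples x ≃+ N ⧸ S :=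
    QuotientAddGroup.quotientAddEquivOfEq hSx.symm
  have := e.toIntLinearEquiv.finrank_eq
  exact congrArg (· + 1) (by convert this using 2 <;> rfl)

end Literature.GroupTheory.FiniteAbelian
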